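import Mathlib.RingTheory.PowerSeries.WeierstrassPreparation
import Mathlib.RingTheory.AdjoinRoot
import Mathlib.LinearAlgebra.Dimension.Constructions
import Mathlib.FieldTheory.Finiteness
import Summits.BirchSwinnertonDyer.BirchSwinnertonDyer.Theorems.ThetaPartnerAtTwoSignedTransportAtTwoUnitOfInvariantsTwo
import HarnessLib

/-!
# Two «next checkable statements» of the θ-transport line on crux (R≥)ᵖ, PROVED verbatim:
# (θ2) `#(k ⊗_{𝔽₂} V) = (#V)^{dim k}` and (K1·L5) `λ(Λ/(f)) = ord_T(f mod 2)` for `f ∈ ℤ₂⟦T⟧`, `f̄ ≠ 0`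

Route `ResidualThetaTransportAtTwo` (RTT), crux (R≥)ᵖ `ResidualThetaCountLowerPureAtTwo`
(stmt-BirchSwinnertonDyer-26074); seat `prover-bsd-wall-rtt-p2` g11 (`--supports`, closes nothing).
HONEST FRAMING: THEOREMS ONLY (no definition, no named fact, no instance, no `sorry`); pure algebra; BSD is
not proved by any of this.

These are the `def … : Prop` statements (θ2) `ResidualBaseChangeCard` and (K1·L5)
`LambdaCyclicEqResidualOrder` of `Cruxes/ResidualThetaCountLowerPureAtTwo/Sketch_cruxidea2_g5.lean`
(crux-ideate #2 r1g5, memo `THETA-LINE-ideator2-r1g5.md`; triage seats TRIAGE-r1-1 and TRIAGE-r1-2 pass the θ-line =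
LINE-DESIGN-g11 «bt26-lambda» first), proved with the SAME binders and conclusion (a Theorems file cannot
import a Cruxes file, so the Props are restated as the theorems' types, character for character):

* `residualBaseChangeCard` (θ2) — for a finite-dimensional `𝔽₂`-module `k` and a finite `𝔽₂`-module `V`,
  `Nat.card (k ⊗[ZMod 2] V) = Nat.card V ^ finrank (ZMod 2) k` (the count half of «the residual
  transport S3 is formal»: `T_g/2T_g ≅ W[2]^{⊕[𝒪_λ:ℤ₂]}`);
* `lambdaCyclicEqResidualOrder` (K1·L5) — for `f ∈ Λ = ℤ₂⟦T⟧` with `f mod 2 ≠ 0`: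
  `lambdaInvariant 2 (Λ ⧸ (f)) = ord_T(f mod 2)` (Weierstrass preparation over `ℤ₂`: `Λ/(f) ≅ ℤ₂[T]/(P)`,
  `P` distinguished of degree `ord_T(f̄)`, free of that rank; `λ = dim_{ℚ₂}(ℚ₂ ⊗_{ℤ₂} ·)` by
  `SignedTransportAtTwo.lambdaInvariant_eq_finrank`) — the `H¹_Iw/Λz`-half of «Kato's defect is residual»
  (card `kato-defect-transport-at-two`), and the `ℤ₂`-model of the `𝒪`-statement
  `LambdaLowerBoundO.free_finrank_quotient_span_of_order_eq` (file `…LambdaLowerBoundOWeierstrass`).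

References: [Washington1997] §7.1 Thm. 7.3 (Weierstrass preparation), §13.2.
-/

set_option autoImplicit false
-- the Theorems namespace of this sub repeats the summit name by design (D-0017 nested layout)
set_option linter.dupNamespace false

noncomputable section

open scoped TensorProduct

open Literature.NumberTheory.EllipticCurves

namespace Summit.BirchSwinnertonDyer.BirchSwinnertonDyer.Theorems.ThetaTransport

/-- **(θ2) Residual base change count** — `#(k ⊗_{𝔽₂} V) = (#V)^{dim_{𝔽₂} k}` for a finite-dimensional
`𝔽₂`-module `k` and a finite `𝔽₂`-module `V` (both sides are `2^{dim k · dim V}`). VERBATIM the Prop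
`ResidualBaseChangeCard` of `Sketch_cruxidea2_g5.lean`. [folklore] -/
theorem residualBaseChangeCard :
    ∀ (k : Type) [AddCommGroup k] [Module (ZMod 2) k] [Module.Finite (ZMod 2) k]
      (V : Type) [AddCommGroup V] [Module (ZMod 2) V] [Finite V],
      Nat.card (k ⊗[ZMod 2] V) = Nat.card V ^ Module.finrank (ZMod 2) k := by
  intro k _ _ _ V _ _ _
  haveI : Fact (Nat.Prime 2) := ⟨Nat.prime_two⟩
  haveI : Finite k := Module.finite_of_finite (ZMod 2)
  haveI : Finite (k ⊗[ZMod 2] V) := Module.finite_of_finite (ZMod 2)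
  letI := Fintype.ofFinite k
  letI := Fintype.ofFinite V
  letI := Fintype.ofFinite (k ⊗[ZMod 2] V)
  rw [Nat.card_eq_fintype_card, Nat.card_eq_fintype_card,
    Module.card_eq_pow_finrank (K := ZMod 2) (V := k ⊗[ZMod 2] V),
    Module.card_eq_pow_finrank (K := ZMod 2) (V := V), Module.finrank_tensorProduct, ← pow_mul,
    mul_comm]

/-- **(K1·L5) `λ` of a cyclic `Λ`-module is the residual `T`-order**: for `f ∈ Λ = ℤ₂⟦T⟧` with
`f mod 2 ≠ 0`, `lambdaInvariant 2 (Λ ⧸ (f)) = ord_T(f mod 2)`. VERBATIM the Prop `LambdaCyclicEqResidualOrder`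
of `Sketch_cruxidea2_g5.lean`. Proof: Weierstrass preparation over the `2`-adically complete `ℤ₂`
(Mathlib `PowerSeries.exists_isWeierstrassFactorization`, `IsWeierstrassFactorizationAt.algEquivQuotient`)
gives `Λ/(f) ≅ ℤ₂[T]/(P)` with `P` distinguished of degree `ord_T(f̄)`; the latter has the power basis
`1, T, …, T^{deg P − 1}`; and `λ = dim_{ℚ₂}(ℚ₂ ⊗_{ℤ₂} ·)` (`SignedTransportAtTwo.lambdaInvariant_eq_finrank`)
is the rank of a free module. [cite: Washington1997, §7.1 Thm. 7.3 and §13.2] -/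
theorem lambdaCyclicEqResidualOrder :
    ∀ f : IwasawaAlgebra 2,
      PowerSeries.map (IsLocalRing.residue ℤ_[2]) f ≠ 0 →
        lambdaInvariant 2 (IwasawaAlgebra 2 ⧸ Ideal.span {f}) =
          (PowerSeries.map (IsLocalRing.residue ℤ_[2]) f).order.toNat := by
  intro f hf
  obtain ⟨P, h, H⟩ := PowerSeries.exists_isWeierstrassFactorization hf
  have hdeg : P.natDegree = (PowerSeries.map (IsLocalRing.residue ℤ_[2]) f).order.toNat :=
    H.natDegree_eq_toNat_order_map
  let pb := AdjoinRoot.powerBasis' H.isDistinguishedAt.monic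
  let e := H.algEquivQuotient.toLinearEquiv
  haveI : Module.Free ℤ_[2] (Polynomial ℤ_[2] ⧸ Ideal.span {P}) :=
    (Module.Free.of_basis pb.basis : Module.Free _ (AdjoinRoot P))
  haveI : Module.Finite ℤ_[2] (Polynomial ℤ_[2] ⧸ Ideal.span {P}) :=
    (Module.Finite.of_basis pb.basis : Module.Finite _ (AdjoinRoot P))
  haveI : Module.Free ℤ_[2] (IwasawaAlgebra 2 ⧸ Ideal.span {f}) := Module.Free.of_equiv e
  haveI : Module.Finite ℤ_[2] (IwasawaAlgebra 2 ⧸ Ideal.span {f}) := Module.Finite.equiv e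
  rw [SignedTransportAtTwo.lambdaInvariant_eq_finrank, Module.finrank_baseChange, ← e.finrank_eq,
    ← hdeg]
  change Module.finrank ℤ_[2] (AdjoinRoot P) = P.natDegree
  rw [pb.finrank, AdjoinRoot.powerBasis'_dim]

end Summit.BirchSwinnertonDyer.BirchSwinnertonDyer.Theorems.ThetaTransport

end
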